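import Summits.HodgeConjecture.CorCM.Census.CentralSquaresStrictCover
import Summits.HodgeConjecture.CorCM.Census.CentralSquaresSwapCalculus

/-!
# The square-central class, IV: star normal forms at the stabilised tie types of a four-type base block, from a strict lowering cover

COR-CM (cell `pub-hodgecm2`), count-neutral kernel combinatorics by the binder seat b09 (gen 45; lane SQUARE-CENTRAL CLASS, part IV), on parts I
(`Census/CentralSquaresStrictCover.lean`: strict lowering covers) and III (`Census/CentralSquaresSwapCalculus.lean`: deviation sets under base change, the
four-type metric) and gen 32ʼs restricted star reduction (`TwistGeneration.single_sub_thetaG_mem_of`), all BY NAME.  Theorems only: no definition, no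
`decide`, no certificate, no named fact, no `sorry`.  HONEST FRAMING: `HC_CM` is NOT proved, here or anywhere in the tree; nothing here is a period or a headline.

THE SETTING (one-sided; part V exchanges `T₀ ↔ T₁`).  Base types `T₀`, `T₁` with base block `{T₀, T̄₀, T₁, T̄₁}` (`hbase`), `|T₀| = 4m`,
`𝓗 = T₀ ∖ T₁` of size `2m`; a SWAP `Q` (`T₀·Q⁻¹ = T₁`, `Q² = 1`) whose place permutation preserves `𝓗`; a base-change stable lattice `L` holding a STRICT
LOWERING COVER (part I).  §1 `face_toward_T₀`: at a type with unique nearest base change `T₀` the cover face has both places in `D = T₀ ∖ X`.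
§2 LEVEL `m` (`single_sub_thetaG_mem_transversal`): for a transversal `T ⊆ 𝓗` of the swap (`t ∈ T ↔ σ_Q t ∉ T`, `|T| = m`) the type with deviation set `T`
is fixed by `Q`, so the cover supplies faces toward BOTH `T₀` and `T₁` there, and below it the nearest base change is unique: star normal form toward `T₀`.
§3 LEVEL `m + 2` (`single_sub_thetaG_mem_transversal_pair`, `m ≥ 3`): for the type with deviation set `T ∪ {a, a'}` (`a ∉ 𝓗`, `a' = σ_Q a ≠ a`), also
fixed by `Q`, the STRICT faces toward `T₀` are those with both places in `T` (a face through `a` has the tie corner `T ∪ {a'}`); a strict face exists, so the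
cover face (or its `Q`-translate) is strict toward `T₀` with places in `T`, and everything below has unique nearest base change `T₀`: star normal form.

## References
* [Pohlmann1968] H. Pohlmann, Algebraic cycles on abelian varieties of complex multiplication type, Ann. of Math. 88 (1968), Thm 1.
-/

namespace Summit.HodgeConjecture.CorCM.Census.CentralSquares

open Finset
open scoped symmDiff
open Summit.HodgeConjecture.CorCM.Prior.AllgGroup.RfwfAllgGroup
open Summit.HodgeConjecture.CorCM.Census.BlockParity
open Summit.HodgeConjecture.CorCM.Census.Coinvariant
open Summit.HodgeConjecture.CorCM.Census.TwistGeneration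
open Summit.HodgeConjecture.CorCM.Census.BaseBlock
open Summit.HodgeConjecture.CorCM.Census.CoverClosure

noncomputable section

variable {G : Type*} [Group G] [Fintype G] [DecidableEq G] (c : G)

/-! ## §0 Cardinalities of symmetric differences; involutive swaps -/

omit [Group G] [Fintype G] in
/-- For `D = S ∪ A` with `S ⊆ 𝓗` and `A` disjoint from `𝓗`: `|𝓗 ∆ D| = |𝓗| − |S| + |A|`. [folklore] -/
theorem card_symmDiff_union (H S A : Finset G) (hS : S ⊆ H) (hA : Disjoint A H) :
    (H ∆ (S ∪ A)).card = H.card - S.card + A.card := by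
  have h1 : H \ (S ∪ A) = H \ S := by
    ext t; simp only [mem_sdiff, mem_union, not_or]
    constructor
    · rintro ⟨h, h', -⟩; exact ⟨h, h'⟩
    · rintro ⟨h, h'⟩; exact ⟨h, h', fun ha => (disjoint_right.mp hA h) ha⟩
  have h2 : (S ∪ A) \ H = A := by
    ext t; simp only [mem_sdiff, mem_union]
    constructor
    · rintro ⟨h | h, h'⟩
      · exact absurd (hS h) h'
      · exact h
    · intro h; exact ⟨Or.inr h, disjoint_left.mp hA h⟩
  rw [symmDiff_def, sup_eq_union, card_union_of_disjoint disjoint_sdiff_sdiff, h1, h2, card_sdiff_of_subset hS]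

omit [Fintype G] [DecidableEq G] in
/-- The place permutation of an involutive swap is an involution: if `t'` lies in the place of `t·Q` then `t` lies in the place of `t'·Q`
(`Q² = 1`, `c² = 1`). [folklore] -/
theorem rep_rep (hc2 : c * c = 1) {Q : G} (hQQ : Q * Q = 1) {t t' : G} (h : t' = t * Q ∨ t' = c * (t * Q)) :
    t = t' * Q ∨ t = c * (t' * Q) := by
  rcases h with rfl | rfl
  · left; rw [mul_assoc, hQQ, mul_one]
  · right; rw [mul_assoc, mul_assoc, hQQ, mul_one, ← mul_assoc, hc2, one_mul]

section OneSided

variable (hc2 : c * c = 1) (hcen : ∀ x : G, x * c = c * x) (T₀ T₁ : CMF G c)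
variable (hbase : ∀ Q : G, rt c Q T₀ = T₀ ∨ rt c Q T₀ = rt c c T₀ ∨ rt c Q T₀ = T₁ ∨ rt c Q T₀ = rt c c T₁)
variable (m : ℕ) (hn : T₀.1.card = 4 * m) (hH : (T₀.1 \ T₁.1).card = 2 * m)
variable (Q : G) (hQ : rt c Q T₀ = T₁) (hQQ : Q * Q = 1)
variable (L : Submodule ℤ (CMF G c →₀ ℤ)) (hLrt : ∀ (Q' : G) (y : CMF G c →₀ ℤ), y ∈ L → Finsupp.mapDomain (rt c Q') y ∈ L)
variable (hcover : ∀ Ψ : CMF G c, 2 ≤ bpot c T₀ Ψ → ∃ Q₂ s s' : G, bpot c T₀ Ψ = ddist (rt c Q₂ T₀) Ψ ∧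
    s ∈ (rt c Q₂ T₀).1 \ Ψ.1 ∧ s' ∈ (rt c Q₂ T₀).1 \ Ψ.1 ∧ s ≠ s' ∧
    gface c hc2 Ψ s s' ∈ L ∧
    ((∃ Q₁ t t' : G, bpot c T₀ Ψ = ddist (rt c Q₁ T₀) Ψ ∧ t ∈ (rt c Q₁ T₀).1 \ Ψ.1 ∧ t' ∈ (rt c Q₁ T₀).1 \ Ψ.1 ∧ t ≠ t' ∧
        (∀ Q' : G, ddist (rt c Q' T₀) (oflipCM c hc2 t Ψ) = bpot c T₀ (oflipCM c hc2 t Ψ) → rt c Q' T₀ = rt c Q₁ T₀) ∧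
        (∀ Q' : G, ddist (rt c Q' T₀) (oflipCM c hc2 t' Ψ) = bpot c T₀ (oflipCM c hc2 t' Ψ) → rt c Q' T₀ = rt c Q₁ T₀) ∧
        (∀ Q' : G, ddist (rt c Q' T₀) (oflipCM c hc2 t (oflipCM c hc2 t' Ψ)) = bpot c T₀ (oflipCM c hc2 t (oflipCM c hc2 t' Ψ)) →
          rt c Q' T₀ = rt c Q₁ T₀)) →
      (∀ Q' : G, ddist (rt c Q' T₀) (oflipCM c hc2 s Ψ) = bpot c T₀ (oflipCM c hc2 s Ψ) → rt c Q' T₀ = rt c Q₂ T₀) ∧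
      (∀ Q' : G, ddist (rt c Q' T₀) (oflipCM c hc2 s' Ψ) = bpot c T₀ (oflipCM c hc2 s' Ψ) → rt c Q' T₀ = rt c Q₂ T₀) ∧
      (∀ Q' : G, ddist (rt c Q' T₀) (oflipCM c hc2 s (oflipCM c hc2 s' Ψ)) = bpot c T₀ (oflipCM c hc2 s (oflipCM c hc2 s' Ψ)) →
        rt c Q' T₀ = rt c Q₂ T₀)))

/-! ## §1 The cover face at a type with unique nearest base change `T₀` -/

include hcover in
/-- If `T₀` is the unique nearest base change of `X` and `X` has potential `≥ 2`, the cover face at `X` has both places in `D(X) = T₀ ∖ X`. [folklore] -/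
theorem face_toward_T₀ (X : CMF G c) (h2 : 2 ≤ bpot c T₀ X)
    (huniq : ∀ Q' : G, ddist (rt c Q' T₀) X = bpot c T₀ X → rt c Q' T₀ = rt c (1 : G) T₀) :
    ∃ s s' : G, s ∈ T₀.1 \ X.1 ∧ s' ∈ T₀.1 \ X.1 ∧ s ≠ s' ∧ gface c hc2 X s s' ∈ L := by
  obtain ⟨Q₂, s, s', hQ₂, hs, hs', hss', hmem, -⟩ := hcover X h2
  have e : rt c Q₂ T₀ = T₀ := by have h := huniq Q₂ hQ₂.symm; rwa [rt_one] at h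
  rw [e] at hs hs'
  exact ⟨s, s', hs, hs', hss', hmem⟩

include hc2 hcen hbase hn hH in
/-- **Below `𝓗`, `T₀` is the unique nearest base change**: a type with deviation set `D ⊆ 𝓗`, `|D| < m`, has `T₀` as its unique nearest base change and
`bpot = |D|`. [folklore] -/
theorem unique_T₀_of_subset_H (X : CMF G c) (hD : T₀.1 \ X.1 ⊆ T₀.1 \ T₁.1) (hlt : (T₀.1 \ X.1).card < m) :
    bpot c T₀ X = (T₀.1 \ X.1).card ∧
      ∀ Q' : G, ddist (rt c Q' T₀) X = bpot c T₀ X → rt c Q' T₀ = rt c (1 : G) T₀ := by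
  have hsd : ((T₀.1 \ T₁.1) ∆ (T₀.1 \ X.1)).card = 2 * m - (T₀.1 \ X.1).card := by
    rw [symmDiff_of_ge hD, card_sdiff_of_subset hD, hH]
  have h1 : (T₀.1 \ X.1).card < T₀.1.card - (T₀.1 \ X.1).card := by rw [hn]; omega
  have h2 : (T₀.1 \ X.1).card < ((T₀.1 \ T₁.1) ∆ (T₀.1 \ X.1)).card := by rw [hsd]; omega
  have h3 : (T₀.1 \ X.1).card < T₀.1.card - ((T₀.1 \ T₁.1) ∆ (T₀.1 \ X.1)).card := by rw [hsd, hn]; omega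
  exact ⟨bpot_eq_card_dev_of_le c T₀ T₁ hbase hc2 hcen X h1.le h2.le h3.le, unique_T₀_of_lt c T₀ T₁ hbase hc2 hcen X h1 h2 h3⟩

/-! ## §2 Level `m`: the transversal type -/

include hcen hbase hn hH hQ hQQ hLrt hcover in
/-- **STAR NORMAL FORM OF A TRANSVERSAL TYPE.**  For a transversal `T ⊆ 𝓗` of the swap (`t ∈ T ↔ σ_Q t ∉ T` on `𝓗`) of size `m ≥ 2`, every type `X` with
deviation set `D(X) ⊆ T` satisfies `[X] − θ_{T₀}(typeSum [X]) ∈ L`; in particular the transversal type itself (`m ≥ 2`). [folklore] -/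
theorem single_sub_thetaG_mem_transversal (hm : 2 ≤ m)
    (hσH : ∀ t ∈ T₀.1, ∀ t' ∈ T₀.1, (t' = t * Q ∨ t' = c * (t * Q)) → (t ∈ T₀.1 \ T₁.1 ↔ t' ∈ T₀.1 \ T₁.1))
    (T : Finset G) (hTH : T ⊆ T₀.1 \ T₁.1) (hTm : T.card = m)
    (hT : ∀ t ∈ T₀.1 \ T₁.1, ∀ t' ∈ T₀.1, (t' = t * Q ∨ t' = c * (t * Q)) → (t ∈ T ↔ t' ∉ T)) :
    ∀ X : CMF G c, T₀.1 \ X.1 ⊆ T → Finsupp.single X 1 - thetaG c hc2 T₀ (typeSum G c (Finsupp.single X 1)) ∈ L := by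
  refine single_sub_thetaG_mem_of c T₀ (fun X => T₀.1 \ X.1 ⊆ T) hc2 L fun X hX h2 => ?_
  -- corners stay in the class
  have hcorner : ∀ s ∈ T₀.1 \ X.1, T₀.1 \ (oflipCM c hc2 s X).1 ⊆ T := fun s hs =>
    (dev_oflip c hc2 (mem_sdiff.mp hs).1 (mem_sdiff.mp hs).2).symm ▸ (erase_subset _ _).trans hX
  have hcorner2 : ∀ s ∈ T₀.1 \ X.1, ∀ s' ∈ T₀.1 \ X.1, s ≠ s' → T₀.1 \ (oflipCM c hc2 s (oflipCM c hc2 s' X)).1 ⊆ T := by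
    intro s hs s' hs' hss'
    have hs'' : s ∈ T₀.1 \ (oflipCM c hc2 s' X).1 := by
      rw [dev_oflip c hc2 (mem_sdiff.mp hs').1 (mem_sdiff.mp hs').2]; exact mem_erase.mpr ⟨hss', hs⟩
    exact (dev_oflip c hc2 (mem_sdiff.mp hs'').1 (mem_sdiff.mp hs'').2).symm ▸ (erase_subset _ _).trans (hcorner s' hs')
  by_cases hXT : T₀.1 \ X.1 = T
  · -- the transversal type itself: a tie between `T₀` and `T₁`; the cover face or its `Q`-translate is toward `T₀`
    have hbp : bpot c T₀ X = m := by
      have hsd : ((T₀.1 \ T₁.1) ∆ (T₀.1 \ X.1)).card = m := by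
        rw [hXT, symmDiff_of_ge hTH, card_sdiff_of_subset hTH, hH, hTm]; omega
      rw [← hTm, ← hXT]
      refine bpot_eq_card_dev_of_le c T₀ T₁ hbase hc2 hcen X ?_ ?_ ?_
      · rw [hXT, hTm, hn]; omega
      · rw [hsd, hXT, hTm]
      · rw [hsd, hn, hXT, hTm]; omega
    obtain ⟨Q₂, s, s', hQ₂, hs, hs', hss', hmem, -⟩ := hcover X (by rw [hbp]; omega)
    -- `rt Q₂ T₀` is `T₀` or `T₁`
    have hQ₂' : rt c Q₂ T₀ = T₀ ∨ rt c Q₂ T₀ = T₁ := by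
      rcases hbase Q₂ with h | h | h | h
      · exact Or.inl h
      · exfalso; rw [h, ddist_compl_base_eq c T₀ hc2 hcen, hbp, hn, hXT, hTm] at hQ₂; omega
      · exact Or.inr h
      · exfalso
        rw [h, ddist_compl_eq c T₀ hc2 hcen, hbp, hn, hXT, symmDiff_of_ge hTH, card_sdiff_of_subset hTH, hH, hTm] at hQ₂; omega
    rcases hQ₂' with h0 | h1
    · rw [h0] at hs hs'
      exact ⟨s, s', hs, hs', hss', hmem, hcorner s hs, hcorner s' hs', hcorner2 s hs s' hs' hss'⟩
    · -- translate the face by `Q`: `X` is `Q`-stable and `T₁·Q⁻¹ = T₀`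
      have hstab : rt c Q X = X :=
        rt_eq_self_of_transversal c T₀ Q (T₀.1 \ T₁.1) (by rw [hQ]) hσH X T ∅ (by rw [union_empty]; exact hXT) hTH
          (empty_subset _) hT (fun t _ t' _ _ => by simp)
      have hT₁Q : rt c Q T₁ = T₀ := by rw [← hQ, ← rt_mul, hQQ, rt_one]
      have hmem' : gface c hc2 X (s * Q⁻¹) (s' * Q⁻¹) ∈ L := by
        have e : gface c hc2 X (s * Q⁻¹) (s' * Q⁻¹) = Finsupp.mapDomain (rt c Q) (gface c hc2 X s s') := by
          rw [mapDomain_rt_gface, hstab]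
        rw [e]; exact hLrt Q _ hmem
      have hsQ : s * Q⁻¹ ∈ T₀.1 \ X.1 := by
        rw [← hT₁Q, ← hstab, mem_sdiff_rt_iff, inv_mul_cancel_right, ← h1]; exact hs
      have hs'Q : s' * Q⁻¹ ∈ T₀.1 \ X.1 := by
        rw [← hT₁Q, ← hstab, mem_sdiff_rt_iff, inv_mul_cancel_right, ← h1]; exact hs'
      have hne : s * Q⁻¹ ≠ s' * Q⁻¹ := fun h => hss' (mul_right_cancel h)
      exact ⟨_, _, hsQ, hs'Q, hne, hmem', hcorner _ hsQ, hcorner _ hs'Q, hcorner2 _ hsQ _ hs'Q hne⟩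
  · -- strictly inside `T`: unique nearest base change `T₀`
    have hlt : (T₀.1 \ X.1).card < m := by
      rw [← hTm]; exact card_lt_card (lt_of_le_of_ne hX hXT |> fun h => h)
    obtain ⟨hbp, huniq⟩ := unique_T₀_of_subset_H c hc2 hcen T₀ T₁ hbase m hn hH X (hX.trans hTH) hlt
    obtain ⟨s, s', hs, hs', hss', hmem⟩ := face_toward_T₀ c hc2 T₀ L hcover X (by rw [hbp]; exact h2) huniq
    exact ⟨s, s', hs, hs', hss', hmem, hcorner s hs, hcorner s' hs', hcorner2 s hs s' hs' hss'⟩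


/-! ## §3 Level `m + 2`: the transversal type with a swapped pair outside `𝓗` -/

include hcen hbase hn hH hQ hQQ hLrt hcover in
/-- **STAR NORMAL FORM AT LEVEL `m + 2`** (`m ≥ 3`).  For a transversal `T ⊆ 𝓗` of the swap of size `m`, a place `a ∈ T₀ ∖ 𝓗` and its image `a' ≠ a` under
the swap, every type `X` whose deviation set is contained in `T ∪ {a, a'}` and is either all of it or does not contain `T` satisfies
`[X] − θ_{T₀}(typeSum [X]) ∈ L`; in particular the type with deviation set `T ∪ {a, a'}`. [folklore] -/
theorem single_sub_thetaG_mem_transversal_pair (hm : 3 ≤ m)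
    (hσH : ∀ t ∈ T₀.1, ∀ t' ∈ T₀.1, (t' = t * Q ∨ t' = c * (t * Q)) → (t ∈ T₀.1 \ T₁.1 ↔ t' ∈ T₀.1 \ T₁.1))
    (T : Finset G) (hTH : T ⊆ T₀.1 \ T₁.1) (hTm : T.card = m)
    (hT : ∀ t ∈ T₀.1 \ T₁.1, ∀ t' ∈ T₀.1, (t' = t * Q ∨ t' = c * (t * Q)) → (t ∈ T ↔ t' ∉ T))
    {a a' : G} (ha : a ∈ T₀.1) (haH : a ∉ T₀.1 \ T₁.1) (ha' : a' ∈ T₀.1) (haa' : a' = a * Q ∨ a' = c * (a * Q)) (hne : a ≠ a') :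
    ∀ X : CMF G c, (T₀.1 \ X.1 ⊆ T ∪ {a, a'} ∧ (T₀.1 \ X.1 = T ∪ {a, a'} ∨ ¬ T ⊆ T₀.1 \ X.1)) →
      Finsupp.single X 1 - thetaG c hc2 T₀ (typeSum G c (Finsupp.single X 1)) ∈ L := by
  have hHsub : T₀.1 \ T₁.1 ⊆ T₀.1 := sdiff_subset
  have ha'H : a' ∉ T₀.1 \ T₁.1 := fun h => haH ((hσH a ha a' ha' haa').mpr h)
  have hA : ({a, a'} : Finset G) ⊆ T₀.1 \ (T₀.1 \ T₁.1) := by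
    intro x hx; rw [mem_insert, mem_singleton] at hx
    rcases hx with rfl | rfl
    · exact mem_sdiff.mpr ⟨ha, haH⟩
    · exact mem_sdiff.mpr ⟨ha', ha'H⟩
  have hAdisj : Disjoint ({a, a'} : Finset G) (T₀.1 \ T₁.1) := by
    rw [disjoint_iff_ne]; rintro x hx y hy rfl; exact (mem_sdiff.mp (hA hx)).2 hy
  have hTA : Disjoint T ({a, a'} : Finset G) := by
    rw [disjoint_iff_ne]; rintro x hx y hy rfl; exact (mem_sdiff.mp (hA hy)).2 (hTH hx)
  have hcardTA : (T ∪ {a, a'}).card = m + 2 := by rw [card_union_of_disjoint hTA, hTm, card_pair hne]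
  have hT₀₁ : T₁ ≠ T₀ := by
    intro h; rw [h, Finset.sdiff_self, Finset.card_empty] at hH; omega
  -- the symmetric difference with `𝓗` of a set `S ∪ B`, `S ⊆ T`, `B ⊆ {a, a'}`
  have hsdcard : ∀ S B : Finset G, S ⊆ T → B ⊆ {a, a'} →
      ((T₀.1 \ T₁.1) ∆ (S ∪ B)).card = 2 * m - S.card + B.card := fun S B hS hB => by
    rw [card_symmDiff_union _ S B (hS.trans hTH) (disjoint_of_subset_left hB hAdisj), hH]
  -- uniqueness of the nearest base change `T₀` for `D = S ∪ B`, `S ⊊ T`-sized, `B ⊆ {a,a'}`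
  have huniq : ∀ X : CMF G c, ∀ S B : Finset G, S ⊆ T → B ⊆ {a, a'} → S.card < m → T₀.1 \ X.1 = S ∪ B →
      bpot c T₀ X = (T₀.1 \ X.1).card ∧ ∀ Q' : G, ddist (rt c Q' T₀) X = bpot c T₀ X → rt c Q' T₀ = rt c (1 : G) T₀ := by
    intro X S B hS hB hSm hD
    have hBcard : B.card ≤ 2 := (card_le_card hB).trans (by rw [card_pair hne])
    have hdisj : Disjoint S B := disjoint_of_subset_left hS (disjoint_of_subset_right hB hTA)
    have hDcard : (T₀.1 \ X.1).card = S.card + B.card := by rw [hD, card_union_of_disjoint hdisj]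
    have hsd : ((T₀.1 \ T₁.1) ∆ (T₀.1 \ X.1)).card = 2 * m - S.card + B.card := by rw [hD]; exact hsdcard S B hS hB
    have h1 : (T₀.1 \ X.1).card < T₀.1.card - (T₀.1 \ X.1).card := by rw [hn, hDcard]; omega
    have h2 : (T₀.1 \ X.1).card < ((T₀.1 \ T₁.1) ∆ (T₀.1 \ X.1)).card := by rw [hsd, hDcard]; omega
    have h3 : (T₀.1 \ X.1).card < T₀.1.card - ((T₀.1 \ T₁.1) ∆ (T₀.1 \ X.1)).card := by rw [hsd, hn, hDcard]; omega
    exact ⟨bpot_eq_card_dev_of_le c T₀ T₁ hbase hc2 hcen X h1.le h2.le h3.le, unique_T₀_of_lt c T₀ T₁ hbase hc2 hcen X h1 h2 h3⟩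
  -- decomposition of a deviation set `D ⊆ T ∪ {a,a'}`
  have hdecomp : ∀ D : Finset G, D ⊆ T ∪ {a, a'} → D = (D ∩ T) ∪ (D ∩ {a, a'}) := fun D hD => by
    ext x; simp only [mem_union, mem_inter]
    constructor
    · intro hx; rcases mem_union.mp (hD hx) with h | h
      · exact Or.inl ⟨hx, h⟩
      · exact Or.inr ⟨hx, h⟩
    · rintro (⟨h, -⟩ | ⟨h, -⟩) <;> exact h
  refine single_sub_thetaG_mem_of c T₀ (fun X => T₀.1 \ X.1 ⊆ T ∪ {a, a'} ∧ (T₀.1 \ X.1 = T ∪ {a, a'} ∨ ¬ T ⊆ T₀.1 \ X.1))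
    hc2 L fun X hX h2 => ?_
  obtain ⟨hXsub, hXor⟩ := hX
  -- corners of a face at deviation places stay in the class once `¬ T ⊆` holds for them
  have hcornerU : ∀ s ∈ T₀.1 \ X.1, s ∈ T → (T₀.1 \ (oflipCM c hc2 s X).1 ⊆ T ∪ {a, a'} ∧
      (T₀.1 \ (oflipCM c hc2 s X).1 = T ∪ {a, a'} ∨ ¬ T ⊆ T₀.1 \ (oflipCM c hc2 s X).1)) := by
    intro s hs hsT
    rw [dev_oflip c hc2 (mem_sdiff.mp hs).1 (mem_sdiff.mp hs).2]
    exact ⟨(erase_subset _ _).trans hXsub, Or.inr fun h => (notMem_erase s _) (h hsT)⟩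
  have hcornerU' : ∀ s ∈ T₀.1 \ X.1, ¬ T ⊆ T₀.1 \ X.1 → (T₀.1 \ (oflipCM c hc2 s X).1 ⊆ T ∪ {a, a'} ∧
      (T₀.1 \ (oflipCM c hc2 s X).1 = T ∪ {a, a'} ∨ ¬ T ⊆ T₀.1 \ (oflipCM c hc2 s X).1)) := by
    intro s hs hnT
    rw [dev_oflip c hc2 (mem_sdiff.mp hs).1 (mem_sdiff.mp hs).2]
    exact ⟨(erase_subset _ _).trans hXsub, Or.inr fun h => hnT (h.trans (erase_subset _ _))⟩
  have hmem_flip : ∀ s ∈ T₀.1 \ X.1, ∀ s' ∈ T₀.1 \ X.1, s ≠ s' → s ∈ T₀.1 \ (oflipCM c hc2 s' X).1 := by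
    intro s hs s' hs' hss'
    rw [dev_oflip c hc2 (mem_sdiff.mp hs').1 (mem_sdiff.mp hs').2]; exact mem_erase.mpr ⟨hss', hs⟩
  rcases hXor with hXeq | hnT
  · -- the top type `Φ`: deviation set `T ∪ {a, a'}`
    have hcardD : (T₀.1 \ X.1).card = m + 2 := by rw [hXeq, hcardTA]
    have hsdD : ((T₀.1 \ T₁.1) ∆ (T₀.1 \ X.1)).card = m + 2 := by
      rw [hXeq, hsdcard T {a, a'} Subset.rfl Subset.rfl, hTm, card_pair hne]; omega
    have hbp : bpot c T₀ X = m + 2 := by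
      rw [← hcardD]
      refine bpot_eq_card_dev_of_le c T₀ T₁ hbase hc2 hcen X ?_ ?_ ?_
      · rw [hn, hcardD]; omega
      · rw [hsdD, hcardD]
      · rw [hn, hsdD, hcardD]; omega
    -- the corners of a face at two places of `T` have unique nearest base change `T₀`
    have hstrictT : ∀ t₁ ∈ T, ∀ t₂ ∈ T, t₁ ≠ t₂ →
        (∀ Q' : G, ddist (rt c Q' T₀) (oflipCM c hc2 t₁ X) = bpot c T₀ (oflipCM c hc2 t₁ X) → rt c Q' T₀ = rt c (1 : G) T₀) ∧
        (∀ Q' : G, ddist (rt c Q' T₀) (oflipCM c hc2 t₁ (oflipCM c hc2 t₂ X)) = bpot c T₀ (oflipCM c hc2 t₁ (oflipCM c hc2 t₂ X)) →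
          rt c Q' T₀ = rt c (1 : G) T₀) := by
      intro t₁ ht₁ t₂ ht₂ h12
      have ht₁D : t₁ ∈ T₀.1 \ X.1 := by rw [hXeq]; exact mem_union_left _ ht₁
      have ht₂D : t₂ ∈ T₀.1 \ X.1 := by rw [hXeq]; exact mem_union_left _ ht₂
      have hnot : ∀ t ∈ T, t ∉ ({a, a'} : Finset G) := fun t ht h => (disjoint_left.mp hTA ht) h
      have hD1 : T₀.1 \ (oflipCM c hc2 t₁ X).1 = T.erase t₁ ∪ {a, a'} := by
        rw [dev_oflip c hc2 (mem_sdiff.mp ht₁D).1 (mem_sdiff.mp ht₁D).2, hXeq, erase_union_distrib, erase_eq_of_notMem (hnot t₁ ht₁)]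
      have ht₁D' : t₁ ∈ T₀.1 \ (oflipCM c hc2 t₂ X).1 := hmem_flip t₁ ht₁D t₂ ht₂D h12
      have hD12 : T₀.1 \ (oflipCM c hc2 t₁ (oflipCM c hc2 t₂ X)).1 = (T.erase t₂).erase t₁ ∪ {a, a'} := by
        rw [dev_oflip c hc2 (mem_sdiff.mp ht₁D').1 (mem_sdiff.mp ht₁D').2,
          dev_oflip c hc2 (mem_sdiff.mp ht₂D).1 (mem_sdiff.mp ht₂D).2, hXeq, erase_union_distrib, erase_eq_of_notMem (hnot t₂ ht₂),
          erase_union_distrib, erase_eq_of_notMem (hnot t₁ ht₁)]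
      refine ⟨(huniq _ (T.erase t₁) {a, a'} (erase_subset _ _) Subset.rfl ?_ hD1).2,
        (huniq _ ((T.erase t₂).erase t₁) {a, a'} ((erase_subset _ _).trans (erase_subset _ _)) Subset.rfl ?_ hD12).2⟩
      · rw [card_erase_of_mem ht₁, hTm]; omega
      · rw [card_erase_of_mem (mem_erase.mpr ⟨h12, ht₁⟩), card_erase_of_mem ht₂, hTm]; omega
    -- a strict lowering triple exists at `X`: two places of `T`
    have hex : ∃ Q₁ t t' : G, bpot c T₀ X = ddist (rt c Q₁ T₀) X ∧ t ∈ (rt c Q₁ T₀).1 \ X.1 ∧ t' ∈ (rt c Q₁ T₀).1 \ X.1 ∧ t ≠ t' ∧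
        (∀ Q' : G, ddist (rt c Q' T₀) (oflipCM c hc2 t X) = bpot c T₀ (oflipCM c hc2 t X) → rt c Q' T₀ = rt c Q₁ T₀) ∧
        (∀ Q' : G, ddist (rt c Q' T₀) (oflipCM c hc2 t' X) = bpot c T₀ (oflipCM c hc2 t' X) → rt c Q' T₀ = rt c Q₁ T₀) ∧
        (∀ Q' : G, ddist (rt c Q' T₀) (oflipCM c hc2 t (oflipCM c hc2 t' X)) = bpot c T₀ (oflipCM c hc2 t (oflipCM c hc2 t' X)) →
          rt c Q' T₀ = rt c Q₁ T₀) := by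
      obtain ⟨t₁, ht₁, t₂, ht₂, h12⟩ := one_lt_card.mp (by rw [hTm]; omega : 1 < T.card)
      refine ⟨1, t₁, t₂, by rw [rt_one, ddist_base_eq, hbp, hcardD], ?_, ?_, h12, (hstrictT t₁ ht₁ t₂ ht₂ h12).1,
        (hstrictT t₂ ht₂ t₁ ht₁ (Ne.symm h12)).1, (hstrictT t₁ ht₁ t₂ ht₂ h12).2⟩
      · rw [rt_one, hXeq]; exact mem_union_left _ ht₁
      · rw [rt_one, hXeq]; exact mem_union_left _ ht₂
    -- the cover face at `X`, strict, toward `T₀` or `T₁`; in the latter case translate by `Q`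
    have hface : ∃ s s' : G, s ∈ T₀.1 \ X.1 ∧ s' ∈ T₀.1 \ X.1 ∧ s ≠ s' ∧ gface c hc2 X s s' ∈ L ∧
        (∀ Q' : G, ddist (rt c Q' T₀) (oflipCM c hc2 s X) = bpot c T₀ (oflipCM c hc2 s X) → rt c Q' T₀ = T₀) ∧
        (∀ Q' : G, ddist (rt c Q' T₀) (oflipCM c hc2 s' X) = bpot c T₀ (oflipCM c hc2 s' X) → rt c Q' T₀ = T₀) := by
      obtain ⟨Q₂, s, s', hQ₂, hs, hs', hss', hmem, hstr⟩ := hcover X (by rw [hbp]; omega)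
      obtain ⟨hu1, hu2, hu3⟩ := hstr hex
      have hQ₂' : rt c Q₂ T₀ = T₀ ∨ rt c Q₂ T₀ = T₁ := by
        rcases hbase Q₂ with h | h | h | h
        · exact Or.inl h
        · exfalso; rw [h, ddist_compl_base_eq c T₀ hc2 hcen, hbp, hn, hcardD] at hQ₂; omega
        · exact Or.inr h
        · exfalso; rw [h, ddist_compl_eq c T₀ hc2 hcen, hbp, hn, hsdD] at hQ₂; omega
      rcases hQ₂' with h0 | h1
      · rw [h0] at hs hs' hu1 hu2
        exact ⟨s, s', hs, hs', hss', hmem, hu1, hu2⟩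
      · -- translate by `Q`
        have hrep_unique : ∀ x y z : G, x ∈ T₀.1 → y ∈ T₀.1 → (x = z ∨ x = c * z) → (y = z ∨ y = c * z) → x = y := by
          intro x y z hx hy h1 h2
          rcases h1 with rfl | rfl <;> rcases h2 with h | h
          · exact h.symm
          · exact absurd (h ▸ hy) ((T₀.2 x).mp hx)
          · subst h; exact absurd hx ((T₀.2 y).mp hy)
          · exact h.symm
        have haback : a = a' * Q ∨ a = c * (a' * Q) := rep_rep c hc2 hQQ haa'
        have hAσ : ∀ t ∈ T₀.1 \ (T₀.1 \ T₁.1), ∀ t' ∈ T₀.1, (t' = t * Q ∨ t' = c * (t * Q)) →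
            (t ∈ ({a, a'} : Finset G) ↔ t' ∈ ({a, a'} : Finset G)) := by
          intro t ht t' ht' h
          have htT₀ : t ∈ T₀.1 := (mem_sdiff.mp ht).1
          have hback : t = t' * Q ∨ t = c * (t' * Q) := rep_rep c hc2 hQQ h
          rw [mem_insert, mem_singleton, mem_insert, mem_singleton]
          constructor
          · rintro (rfl | rfl)
            · exact Or.inr (hrep_unique t' a' (t * Q) ht' ha' h haa')
            · exact Or.inl (hrep_unique t' a (t * Q) ht' ha h haback)
          · rintro (rfl | rfl)
            · exact Or.inr (hrep_unique t a' (t' * Q) htT₀ ha' hback haa')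
            · exact Or.inl (hrep_unique t a (t' * Q) htT₀ ha hback haback)
        have hstab : rt c Q X = X :=
          rt_eq_self_of_transversal c T₀ Q (T₀.1 \ T₁.1) (by rw [hQ]) hσH X T {a, a'} hXeq hTH hA hT hAσ
        have hT₁Q : rt c Q T₁ = T₀ := by rw [← hQ, ← rt_mul, hQQ, rt_one]
        obtain ⟨h1', hsQ, hs'Q, hneQ, hu1', hu2', -⟩ := strict_rt c T₀ hc2 Q hQ₂ hs hs' hss' hu1 hu2 hu3
        rw [hstab] at hsQ hs'Q hu1' hu2'
        rw [rt_mul, h1, hT₁Q] at hsQ hs'Q hu1' hu2'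
        have hmem' : gface c hc2 X (s * Q⁻¹) (s' * Q⁻¹) ∈ L := by
          have e : gface c hc2 X (s * Q⁻¹) (s' * Q⁻¹) = Finsupp.mapDomain (rt c Q) (gface c hc2 X s s') := by
            rw [mapDomain_rt_gface, hstab]
          rw [e]; exact hLrt Q _ hmem
        exact ⟨_, _, hsQ, hs'Q, hneQ, hmem', hu1', hu2'⟩
    obtain ⟨s, s', hs, hs', hss', hmem, hu1, hu2⟩ := hface
    -- the two places are in `T`: a place `a` or `a'` would leave a tie corner
    have htie : ∀ b ∈ ({a, a'} : Finset G), ∀ s₀ ∈ T₀.1 \ X.1,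
        (∀ Q' : G, ddist (rt c Q' T₀) (oflipCM c hc2 s₀ X) = bpot c T₀ (oflipCM c hc2 s₀ X) → rt c Q' T₀ = T₀) → s₀ ≠ b := by
      intro b hb s₀ hs₀ hu hsb
      subst hsb
      -- the corner has deviation set `T ∪ ({a,a'} ∖ b)`: a tie between `T₀` and `T₁`
      have hD : T₀.1 \ (oflipCM c hc2 s₀ X).1 = T ∪ ({a, a'} : Finset G).erase s₀ := by
        rw [dev_oflip c hc2 (mem_sdiff.mp hs₀).1 (mem_sdiff.mp hs₀).2, hXeq, erase_union_distrib, erase_eq_of_notMem]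
        exact fun h => (disjoint_left.mp hTA h) hb
      have hcard : (T₀.1 \ (oflipCM c hc2 s₀ X).1).card = m + 1 := by
        rw [hD, card_union_of_disjoint (disjoint_of_subset_right (erase_subset _ _) hTA), hTm, card_erase_of_mem hb, card_pair hne]
      have hsd : ((T₀.1 \ T₁.1) ∆ (T₀.1 \ (oflipCM c hc2 s₀ X).1)).card = m + 1 := by
        rw [hD, hsdcard T _ Subset.rfl (erase_subset _ _), hTm, card_erase_of_mem hb, card_pair hne]; omega
      have hbp' : bpot c T₀ (oflipCM c hc2 s₀ X) = m + 1 := by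
        rw [← hcard]
        refine bpot_eq_card_dev_of_le c T₀ T₁ hbase hc2 hcen _ ?_ ?_ ?_
        · rw [hn, hcard]; omega
        · rw [hsd, hcard]
        · rw [hn, hsd, hcard]; omega
      have h := hu Q (by rw [hQ, ddist_eq_card_symmDiff c T₀ hc2, hsd, hbp'])
      rw [hQ] at h
      exact hT₀₁ h
    have hsT : s ∈ T := by
      have hsD : s ∈ T ∪ {a, a'} := hXeq ▸ hs
      rcases mem_union.mp hsD with h | h
      · exact h
      · exact absurd rfl (htie s h s hs hu1)
    have hs'T : s' ∈ T := by
      have hsD : s' ∈ T ∪ {a, a'} := hXeq ▸ hs'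
      rcases mem_union.mp hsD with h | h
      · exact h
      · exact absurd rfl (htie s' h s' hs' hu2)
    refine ⟨s, s', hs, hs', hss', hmem, hcornerU s hs hsT, hcornerU s' hs' hs'T, ?_⟩
    have hs'' : s ∈ T₀.1 \ (oflipCM c hc2 s' X).1 := hmem_flip s hs s' hs' hss'
    obtain ⟨h1, h2⟩ := hcornerU s' hs' hs'T
    rw [dev_oflip c hc2 (mem_sdiff.mp hs'').1 (mem_sdiff.mp hs'').2]
    refine ⟨(erase_subset _ _).trans h1, Or.inr fun h => ?_⟩
    rcases h2 with h2 | h2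
    · exact (notMem_erase s _) (h hsT)
    · exact h2 (h.trans (erase_subset _ _))
  · -- below the top: `¬ T ⊆ D`, unique nearest base change `T₀`
    set D := T₀.1 \ X.1 with hDdef
    have hS : D ∩ T ⊆ T := inter_subset_right
    have hB : D ∩ {a, a'} ⊆ ({a, a'} : Finset G) := inter_subset_right
    have hSlt : (D ∩ T).card < m := by
      rw [← hTm]
      refine card_lt_card (lt_of_le_of_ne inter_subset_right fun h => hnT ?_)
      rw [← h]; exact inter_subset_left
    obtain ⟨hbp, hun⟩ := huniq X (D ∩ T) (D ∩ {a, a'}) hS hB hSlt (hdecomp D hXsub)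
    obtain ⟨s, s', hs, hs', hss', hmem⟩ := face_toward_T₀ c hc2 T₀ L hcover X (by rw [hbp]; exact h2) hun
    refine ⟨s, s', hs, hs', hss', hmem, hcornerU' s hs hnT, hcornerU' s' hs' hnT, ?_⟩
    have hs'' : s ∈ T₀.1 \ (oflipCM c hc2 s' X).1 := hmem_flip s hs s' hs' hss'
    rw [dev_oflip c hc2 (mem_sdiff.mp hs'').1 (mem_sdiff.mp hs'').2,
      dev_oflip c hc2 (mem_sdiff.mp hs').1 (mem_sdiff.mp hs').2]
    exact ⟨((erase_subset _ _).trans (erase_subset _ _)).trans hXsub,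
      Or.inr fun h => hnT (h.trans ((erase_subset _ _).trans (erase_subset _ _)))⟩

end OneSided

end

end Summit.HodgeConjecture.CorCM.Census.CentralSquares
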